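import Mathlib
import Summits.QuantumFields.YangMills.Theses.HyperbolicRegulator
import Literature.MathematicalPhysics.QuantumLattice.LatticeGaugeDLR

/-!
# Sketch — crux-ideate round 1 (ideator 1) for `CurvatureAnchor` (stmt-QuantumFields-15826)

First lemmas of the three crux idea cards, as Lean signatures over existing declarations
(not proved; they must elaborate):

* `collar_displacement`   — card `frozen-localised-torons` (geodesic localisation of torons):
  the exact displacement of a hyperbolic translation of length `log l` at a point `z` of the
  upper half plane, `cosh d(z, l•z) = 1 + 2 sinh²(log l / 2) · (‖z‖ / Im z)²`, where
  `‖z‖ / Im z = cosh(dist(z, axis))`: a based loop in the class of a closed geodesic of length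
  `ℓ` through a point at distance `r` from it has length `≥ ℓ` growing like `2r`.
* `demko_decay`           — card `witten-cbs-angle` (and `giant_beta_gjs` step (2)): the
  Demko–Moss–Smith bound — the inverse of a banded symmetric positive definite matrix decays
  exponentially in the graph distance at rate `≍ √(a/b)` (square root of the inverse condition
  number), i.e. rate `≍ 1/k` from a spectral gap `≍ 1/k²`, with NO hyperbolicity input.
* `GoodBoundaryCoreRegularity` — card `compactness-disagreement`: on a fixed block of `ℤ⁴`,
  for every boundary condition that is `δ₀`-flat on the boundary layer, the Wilson DLR kernel at
  `β ≥ β₀(L, δ, ε)` puts mass `≥ 1 − ε` on configurations that are `δ`-flat on the core.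
-/

noncomputable section

namespace Summit.QuantumFields.YangMills.Cruxes.CurvatureAnchor.IdeateR1K1

open scoped BigOperators
open MeasureTheory

/-! ## Card `frozen-localised-torons` — first lemma (hyperbolic displacement / collar growth) -/

open UpperHalfPlane in
/-- Displacement of the hyperbolic translation `z ↦ l • z` (axis = imaginary axis, translation
length `|log l|`): `cosh (dist z (l • z)) = 1 + 2 sinh² (log l / 2) (‖z‖ / Im z)²`; since
`‖z‖ / Im z = cosh r` with `r` the distance from `z` to the axis, the based-loop length at
distance `r` from a closed geodesic of length `ℓ` satisfies `cosh d = 1 + 2 sinh²(ℓ/2) cosh² r`,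
so `d ≥ ℓ` and `d ≥ 2r + 2 log sinh(ℓ/2)`. (Mathlib `UpperHalfPlane.cosh_dist`.) -/
theorem collar_displacement (l : {x : ℝ // 0 < x}) (z : ℍ) :
    Real.cosh (dist z (l • z)) =
      1 + 2 * Real.sinh (Real.log (l : ℝ) / 2) ^ 2 * (‖(z : ℂ)‖ / z.im) ^ 2 := by
  sorry

open scoped Kronecker in
/-- **Transverse freezing, linear-algebra core (card `frozen-localised-torons`, mechanism M2).** The
one-loop free energy `½ log det` of a KRONECKER SUM `A ⊗ 1 + 1 ⊗ B` (Künneth: `Δ₁^{S×S} = Δ^S ⊗ 1 + 1 ⊗ Δ^S`,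
stub_kunneth) responds to a change `A₀ ↦ A₁ ≥ A₀` of the FIRST factor (twisting the factor-1 Laplacian by a
toron raises it, Kato/diamagnetic) by at least `m ×` the single-factor response at the top transverse
eigenvalue, `m = dim` of the transverse factor: the toron's effective potential is EXTENSIVE in the
transverse volume (Gross–Pisarski–Yaffe / Weiss potential of the Polyakov loop, here for every essential
cycle of `S_j`). Proof: simultaneous diagonalisation of `B`; `μ ↦ tr log(A₁+μ) − tr log(A₀+μ)` is
non-increasing. -/
theorem kroneckerSum_logDet_extensive {n m : ℕ} (A₀ A₁ : Matrix (Fin n) (Fin n) ℝ)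
    (B : Matrix (Fin m) (Fin m) ℝ) (h₀ : A₀.PosDef) (h₁ : A₁.PosDef) (hB : B.PosSemidef)
    (hle : (A₁ - A₀).PosSemidef) (b : ℝ) (hb : ∀ x : Fin m → ℝ, x ⬝ᵥ B.mulVec x ≤ b * (x ⬝ᵥ x)) :
    (m : ℝ) * (Real.log (A₁ + b • (1 : Matrix (Fin n) (Fin n) ℝ)).det -
        Real.log (A₀ + b • (1 : Matrix (Fin n) (Fin n) ℝ)).det) ≤
      Real.log (A₁ ⊗ₖ (1 : Matrix (Fin m) (Fin m) ℝ) + (1 : Matrix (Fin n) (Fin n) ℝ) ⊗ₖ B).det -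
        Real.log (A₀ ⊗ₖ (1 : Matrix (Fin m) (Fin m) ℝ) + (1 : Matrix (Fin n) (Fin n) ℝ) ⊗ₖ B).det := by
  sorry

/-! ## Card `witten-cbs-angle` — first lemma (Demko–Moss–Smith decay of banded SPD inverses) -/

/-- **Demko–Moss–Smith.** `M` a real symmetric matrix, banded with respect to the graph `Γ`
(`M i j = 0` unless `i = j` or `i ~ j`), with quadratic form between `a‖x‖²` and `b‖x‖²`
(`0 < a ≤ b`). If `u` is supported in `A`, `v` in `B`, and every pair `(i, j) ∈ A × B` is at
graph distance `> L`, then `|uᵀ M⁻¹ v| ≤ (2/a) q^L ‖u‖ ‖v‖` with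
`q = (√(b/a) − 1)/(√(b/a) + 1)`, i.e. decay rate `−log q ≈ 2√(a/b)`: for the Künneth-gapped
1-form Laplacian (`a ≍ 1/k²`, `b = O(1)`) the Gaussian covariance decays at rate `≍ 1/k`
from the gap ALONE (Chebyshev approximation of `1/x` on `[a, b]`; a degree-`< L` polynomial
in a banded matrix vanishes between sets at distance `> L`). -/
theorem demko_decay {ι : Type} [Fintype ι] [DecidableEq ι] (Γ : SimpleGraph ι)
    (M : Matrix ι ι ℝ) (a b : ℝ) (ha : 0 < a) (hab : a ≤ b) (hsymm : M.IsSymm)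
    (hband : ∀ i j, i ≠ j → ¬ Γ.Adj i j → M i j = 0)
    (hlow : ∀ x : ι → ℝ, a * ∑ i, x i ^ 2 ≤ ∑ i, ∑ j, x i * M i j * x j)
    (hup : ∀ x : ι → ℝ, ∑ i, ∑ j, x i * M i j * x j ≤ b * ∑ i, x i ^ 2)
    (A B : Finset ι) (L : ℕ) (hfar : ∀ i ∈ A, ∀ j ∈ B, (L : ℕ∞) < Γ.edist i j)
    (u v : ι → ℝ) (hu : ∀ i ∉ A, u i = 0) (hv : ∀ j ∉ B, v j = 0) :
    |∑ i, ∑ j, u i * M⁻¹ i j * v j| ≤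
      (2 / a) * ((Real.sqrt (b / a) - 1) / (Real.sqrt (b / a) + 1)) ^ L *
        Real.sqrt (∑ i, u i ^ 2) * Real.sqrt (∑ j, v j ^ 2) := by
  sorry

/-! ## Card `compactness-disagreement` — first lemma (core regularity for good boundary data) -/

open Literature.MathematicalPhysics.QuantumLattice Literature.Probability.LatticeModels in
/-- **Core regularity of the Wilson block kernel for good boundary data** (the soft, fixed-block
`β → ∞` statement the line starts from; `ℤ⁴` = the flat blocks of the complex). For every
block size `L`, target flatness `δ` and failure probability `ε` there are a boundary flatness
`δ₀ > 0` and a threshold `β₀` such that for all `β ≥ β₀` and EVERY boundary condition `η` whose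
boundary-layer plaquettes (those touching the block `Λ = [-4L, 4L]⁴` without lying inside it)
are `δ₀`-flat, the DLR kernel `ymSpecification ρ β Λ η` gives probability `≥ 1 − ε` to the
event "every plaquette based in the core `[-L, L]⁴` is `δ`-flat". (Minimisers spread incoming
flux, boundary noise decays inward; Laplace asymptotics on the compact manifold `G^Λ`,
uniform over the compact set of good `η` — no expansion.) -/
def GoodBoundaryCoreRegularity {G : Type} [Group G] [TopologicalSpace G] [IsTopologicalGroup G]
    [CompactSpace G] [MeasurableSpace G] [BorelSpace G] {N : ℕ}
    (ρ : G →* Matrix (Fin N) (Fin N) ℂ) : Prop :=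
  ∀ (L : ℕ) (δ ε : ℝ), 0 < δ → 0 < ε → ∃ δ₀ : ℝ, 0 < δ₀ ∧ ∃ β₀ : ℝ, ∀ β : ℝ, β₀ ≤ β →
    let box : ℕ → Finset (Site 4) := fun R => Fintype.piFinset fun _ : Fin 4 => Finset.Icc (-(R : ℤ)) R
    let Λ : Finset (ZdEdge 4) := box (4 * L) ×ˢ Finset.univ
    ∀ η : LGConfig 4 G,
      (∀ p ∈ plaquettesTouching Λ, ¬ (plaquetteEdges p ⊆ Λ) →
          (N : ℝ) - δ₀ ≤ plaquetteObs ρ p.1 p.2.1.1 p.2.1.2 η) →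
      ENNReal.ofReal (1 - ε) ≤
        ymSpecification ρ β Λ η
          {U | ∀ x ∈ box L, ∀ i j : Fin 4, i < j → (N : ℝ) - δ ≤ plaquetteObs ρ x i j U}

end Summit.QuantumFields.YangMills.Cruxes.CurvatureAnchor.IdeateR1K1
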